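/-
Copyright: literature formalisation for the harness. Statements follow the cited text.
-/
import Literature.AlgebraicGeometry.CossartPiltant200819.StableModelCriterion2008
import Literature.AlgebraicGeometry.Resolution.NormalizationOfVarietiesProofs
import Mathlib.RingTheory.Localization.Integral
import Mathlib.RingTheory.Polynomial.ScaleRoots
import Mathlib.RingTheory.Valuation.Integral
import HarnessLib

/-!
# Cossart–Piltant I (2008), §3 / Prop 6.2: `R̃` is a local model of `W` — discharge of `NormalModelAboveLe`

V. Cossart, O. Piltant, *Resolution of singularities of threefolds in positive characteristic I*,
J. Algebra 320 (2008) 1051–1082 [CossartPiltant2008]; manuscript hal-00139124 ("HAL").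
HAL §3, printed p. 4 l. 20–23: "Suppose that `L/K` is a finite field extension and `R` is a normal
local ring such that `QF(R) = K`. We say that a subring `S` of `L` lies over `R` and `R` lies
below `S` if `S` is the localization at a maximal ideal of the integral closure of `R` in `L`. In
particular, `S` is then a normal local ring such that `QF(S) = L`." Prop 6.2, printed p. 17
l. 43–44: "let `R̃` be the unique normal local model of `W/k` which lies above `R`".

That `R̃` IS a local model of `W/k` (the localization at a prime of a `k`-algebra OF FINITE TYPE
with fraction field `L`, dominated by `W`) is the finiteness of integral closure for affine
domains (E. Noether). The tree module `StableModelCriterion2008.lean` (pub-hironaka gen 9) left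
this as the NAMED STATEMENT `CP2008.NormalModelAboveLe` — one of the six named hypotheses
(`h93`, `h₁`, `hcof`, `hnm`, `hFu`, `hst`) of `CP2008.tamePrimeDescentHighRank_of_leaves`. This
file PROVES it (`CP2008.normalModelAboveLe_holds`) from the tree's discharged Noether theorem
`Resolution.NoetherFiniteIntegralClosure_holds` ([Liu2002] Prop. 4.1.27, PROVED in
`NormalizationOfVarietiesProofs.lean`) and Mathlib, and records the corollary
`CP2008.tamePrimeDescentHighRank_of_leaves'` with that hypothesis removed (five named hypotheses
left: `DescentBelowInertiaField`, `TamePrimeDescentViaStableModel`, `Cofinality`,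
`FuPrimaryTransform`, `ConjugateStability`). Of these, `ConjugateStability` has since been PROVED
in the tree as well (`CP2008.conjugateStability_holds`, module `ConjugateStability2008.lean`, via
the local Zariski Main Theorem of `Resolution/NormalBirationalQuasiFinite.lean`); it is not
imported here (neither module imports the other), so the assemblies with BOTH bookkeeping
hypotheses `hnm`, `hst` discharged belong downstream, in modules importing this file and
`ConjugateStability2008.lean` together. The hypotheses that remain statements of the
literature are `DescentBelowInertiaField` (HAL Prop. 9.3, p. 27), `TamePrimeDescentViaStableModel`
(HAL p. 30 l. 16–65), `Cofinality` (HAL Cor. 4.6, p. 15) and `FuPrimaryTransform` ([Fu1997]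
Thm. 3.6).

## The proof (folklore; dimension- and characteristic-free)

Let `R₀ = A_𝔭 ⊆ K` with `A` a finitely generated `k`-algebra, `Frac A = K`, `A ⊆ V := W ∩ K`,
`𝔭` the centre of `V`. Let `B ⊆ L` be the integral closure of `A` in `L`.
* `B` is a finite `A`-module (Noether, `L/K` finite), hence a finitely generated `k`-algebra
  (`integralClosureSub_fg`);
* `Frac B = L`: every `z ∈ L` is algebraic over `K = Frac A`, so `a z ∈ B` for some
  `0 ≠ a ∈ A` (`isFractionRing_integralClosureSub`);
* `B ⊆ W`: valuation rings are integrally closed (`mem_of_isIntegral_of_forall_mem`);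
* so `T := B_{𝔮}`, `𝔮 = m_W ∩ B`, i.e. the fractions `b/s`, `b, s ∈ B`, `W(s) = 0`, is a local
  model of `W` (Mathlib's `Localization.subalgebra.ofField`, via the tree's
  `coe_ofField_centre`);
* `R̃₀ = normalModelAbove W R₀ ⊆ T`: an element of `L` integral over `R₀ = A_𝔭` becomes integral
  over `A` after multiplication by a unit `S ∈ A ∖ 𝔭` of `R₀` (clear the denominators of the
  integral equation with `Polynomial.scaleRoots`, `exists_mem_integral_mul_of_isIntegralOverSub`),
  so `b/t = (S b · S')/(S' t · S)` with numerator and denominator in `B` and the denominator a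
  unit of `W`.
(In fact `T = R̃₀`; only `⊆` is asked by `NormalModelAboveLe`. Normality of `R₀` is not used.)

Cell record: pub-hironaka GAPS §GA row G10-A21.S-N (named-fact debt of G9-A21.S-R: 5 ↦ 4).
No statement of [CossartPiltant2008] is contradicted by anything in this file.

## Sources

* V. Cossart, O. Piltant, J. Algebra 320 (2008) = HAL hal-00139124, §3 (printed p. 4 l. 17–23,
  l. 32–34) and Prop. 6.2 (printed p. 17 l. 43–44). [CossartPiltant2008]
* Q. Liu, *Algebraic Geometry and Arithmetic Curves* (2002), Prop. 4.1.27 (E. Noether's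
  finiteness of integral closure). [Liu2002]
-/

noncomputable section

namespace Literature.AlgebraicGeometry.CossartPiltant200819.CP2008

open Literature.AlgebraicGeometry.Resolution Polynomial

universe u

section Valuation

variable {F : Type u} [Field F]

/-- `O(x) = 1` iff `x` is a unit of the valuation ring `O`: `x ≠ 0`, `x ∈ O`, `x⁻¹ ∈ O`.
[folklore] -/
theorem valuation_eq_one_iff_ne_zero_mem_inv_mem (O : ValuationSubring F) (x : F) :
    O.valuation x = 1 ↔ x ≠ 0 ∧ x ∈ O ∧ x⁻¹ ∈ O := by
  constructor
  · intro h
    have hx0 : x ≠ 0 := by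
      rintro rfl
      simp at h
    refine ⟨hx0, (O.valuation_le_one_iff x).mp h.le, (O.valuation_le_one_iff x⁻¹).mp ?_⟩
    rw [map_inv₀, h, inv_one]
  · rintro ⟨hx0, hx, hxi⟩
    have hu : IsUnit (⟨x, hx⟩ : O) :=
      isUnit_iff_exists_inv.mpr ⟨⟨x⁻¹, hxi⟩, Subtype.ext (mul_inv_cancel₀ hx0)⟩
    exact (O.valuation_eq_one_iff ⟨x, hx⟩).mp hu

/-- An element of value `1` is non-zero. [folklore] -/
theorem ne_zero_of_valuation_eq_one (O : ValuationSubring F) {x : F} (h : O.valuation x = 1) :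
    x ≠ 0 :=
  ((valuation_eq_one_iff_ne_zero_mem_inv_mem O x).mp h).1

/-- Pulling a valuation ring back along a field map preserves "value `1`" (units of `W ∩ K` are
the elements of `K` which are units of `W`). [folklore] -/
theorem comap_valuation_eq_one_iff' {K L : Type u} [Field K] [Field L] [Algebra K L]
    (W : ValuationSubring L) (s : K) :
    (W.comap (algebraMap K L)).valuation s = 1 ↔ W.valuation (algebraMap K L s) = 1 := by
  rw [valuation_eq_one_iff_ne_zero_mem_inv_mem, valuation_eq_one_iff_ne_zero_mem_inv_mem,
    ValuationSubring.mem_comap, ValuationSubring.mem_comap, map_inv₀, _root_.map_ne_zero]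

/-- The valuation ring `W` of `L` is the ring of integers of its valuation (Mathlib's
`Valuation.Integers` interface). [folklore] -/
theorem integers_valuationSubring {L : Type u} [Field L] (W : ValuationSubring L) :
    W.valuation.Integers W where
  hom_inj := Subtype.val_injective
  map_le_one := fun x => W.valuation_le_one x
  exists_of_le_one := fun r hr => ⟨⟨r, (W.valuation_le_one_iff r).mp hr⟩, rfl⟩

end Valuation

section IntegralClosureModel

variable {k K L : Type u} [Field k] [Field K] [Algebra k K] [Field L] [Algebra K L] [Algebra k L]
  [IsScalarTower k K L]

omit [Algebra k L] [IsScalarTower k K L] in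
/-- **Valuation rings are integrally closed**: an element of `L` integral over a subring
`A ⊆ K` which maps into `W` lies in `W`. [folklore] -/
theorem mem_of_isIntegral_of_forall_mem (W : ValuationSubring L) (A : Subalgebra k K)
    (hAW : ∀ a ∈ A, algebraMap K L a ∈ W) {x : L} (hx : IsIntegral A x) : x ∈ W := by
  let f : A →+* W :=
    { toFun := fun a => ⟨algebraMap K L a, hAW a a.2⟩
      map_one' := Subtype.ext (by simp)
      map_mul' := fun a b => Subtype.ext (by simp)
      map_zero' := Subtype.ext (by simp)
      map_add' := fun a b => Subtype.ext (by simp) }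
  have hx' : IsIntegral W x := by
    obtain ⟨p, hp, hpx⟩ := hx
    refine ⟨p.map f, hp.map f, ?_⟩
    rw [Polynomial.eval₂_map]
    have hcomp : (algebraMap W L).comp f = algebraMap A L := RingHom.ext fun a => rfl
    rw [hcomp]
    exact hpx
  have hmem := Valuation.Integers.mem_of_integral (integers_valuationSubring W) hx'
  exact (W.valuation_le_one_iff x).mp ((Valuation.mem_integer_iff _ _).mp hmem)

variable (k) in
/-- The integral closure of the affine model `A ⊆ K` in `L`, as a `k`-subalgebra of `L`.
[folklore] -/
def integralClosureSub (A : Subalgebra k K) : Subalgebra k L :=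
  (integralClosure A L).restrictScalars k

/-- Membership in `integralClosureSub`. [folklore] -/
theorem mem_integralClosureSub_iff (A : Subalgebra k K) (x : L) :
    x ∈ integralClosureSub k (L := L) A ↔ IsIntegral A x := by
  simp [integralClosureSub, Subalgebra.mem_restrictScalars, mem_integralClosure_iff]

/-- **E. Noether ⇒ the integral closure of an affine model in a finite extension is an affine
`k`-algebra.** [cite: Liu2002, Prop. 4.1.27, p. 122] -/
theorem integralClosureSub_fg (A : Subalgebra k K) (hA : A.FG) [IsFractionRing A K]
    [FiniteDimensional K L] : (integralClosureSub k (L := L) A).FG := by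
  haveI : Algebra.FiniteType k A := (Subalgebra.fg_iff_finiteType A).mp hA
  haveI hN : Module.Finite A (integralClosure A L) := NoetherFiniteIntegralClosure_holds k A K L
  have h1 : (⊤ : Subalgebra k A).FG := Algebra.FiniteType.out
  have h2 : (⊤ : Subalgebra A (integralClosure A L)).FG :=
    Subalgebra.fg_of_submodule_fg (Module.finite_def.mp hN)
  have h3 : (⊤ : Subalgebra k (integralClosure A L)).FG := Algebra.fg_trans' h1 h2
  have h4 : (⊤ : Subalgebra k (integralClosure A L)).map
      (((integralClosure A L).val).restrictScalars k) = integralClosureSub k (L := L) A := by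
    ext x
    constructor
    · rintro hx
      obtain ⟨y, -, rfl⟩ := Subalgebra.mem_map.mp hx
      exact y.2
    · intro hx
      exact Subalgebra.mem_map.mpr ⟨⟨x, hx⟩, Algebra.mem_top, rfl⟩
  rw [← h4]
  exact h3.map _

/-- **`Frac B = L`** for the integral closure `B` of `A` (`Frac A = K`) in the finite extension
`L/K`: every `z ∈ L` is `b/a` with `b ∈ B`, `0 ≠ a ∈ A`. [folklore] -/
theorem isFractionRing_integralClosureSub (A : Subalgebra k K) [IsFractionRing A K]
    [FiniteDimensional K L] : IsFractionRing (integralClosureSub k (L := L) A) L := by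
  haveI : Algebra.IsIntegral K L := Algebra.IsIntegral.of_finite K L
  apply IsFractionRing.of_field
  intro z
  have hz : IsIntegral K z := Algebra.IsIntegral.isIntegral z
  obtain ⟨m, hm⟩ := IsIntegral.exists_multiple_integral_of_isLocalization (nonZeroDivisors A) z hz
  have hm0 : (m : A) ≠ 0 := nonZeroDivisors.coe_ne_zero m
  have hmL : algebraMap K L ((m : A) : K) ≠ 0 := by
    rw [_root_.map_ne_zero]
    exact_mod_cast hm0
  have hint : IsIntegral A (algebraMap K L ((m : A) : K)) := by
    have : algebraMap K L ((m : A) : K) = algebraMap A L (m : A) := rfl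
    rw [this]
    exact isIntegral_algebraMap
  refine ⟨⟨(m : A) • z, (mem_integralClosureSub_iff A _).mpr hm⟩,
    ⟨algebraMap K L ((m : A) : K), (mem_integralClosureSub_iff A _).mpr hint⟩, ?_⟩
  change z = ((m : A) • z) / algebraMap K L ((m : A) : K)
  rw [eq_div_iff hmL, Algebra.smul_def, mul_comm]
  rfl

omit [Algebra k L] [IsScalarTower k K L] in
/-- **Clearing denominators** (`R₀ = A_𝔭`): if `b ∈ L` is integral over the ring of fractions
`{a/s : a, s ∈ A, V(s) = 0}`, then `S · b` is integral over `A` for some `S ∈ A` with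
`W(S) = 0` (a product of denominators of the integral equation; `Polynomial.scaleRoots`).
[folklore] -/
theorem exists_mem_integral_mul_of_isIntegralOverSub (W : ValuationSubring L)
    (A R₀ : Subalgebra k K)
    (hR₀ : (R₀ : Set K) = {x | ∃ a ∈ A, ∃ s ∈ A,
      (W.comap (algebraMap K L)).valuation s = 1 ∧ x = a * s⁻¹})
    {b : L} (hb : IsIntegralOverSub R₀ b) :
    ∃ S ∈ A, W.valuation (algebraMap K L S) = 1 ∧ IsIntegral A (algebraMap K L S * b) := by
  classical
  obtain ⟨q, hqm, hqc, hqb⟩ := hb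
  have hrep : ∀ i, ∃ a ∈ A, ∃ s ∈ A,
      (W.comap (algebraMap K L)).valuation s = 1 ∧ q.coeff i = a * s⁻¹ := by
    intro i
    have h := hqc i
    rw [← SetLike.mem_coe, hR₀] at h
    exact h
  choose a ha s hs hvs hq using hrep
  set n := q.natDegree with hn
  set S : K := ∏ i ∈ Finset.range n, s i with hS
  have hSA : S ∈ A := Subalgebra.prod_mem A fun i _ => hs i
  have hvS : (W.comap (algebraMap K L)).valuation S = 1 := by
    rw [hS, map_prod]
    exact Finset.prod_eq_one fun i _ => hvs i
  refine ⟨S, hSA, (comap_valuation_eq_one_iff' W S).mp hvS, ?_⟩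
  -- the scaled equation has coefficients in `A`
  set Q := q.scaleRoots S with hQ
  have hQcoeff : ∀ i, Q.coeff i ∈ A := by
    intro i
    rw [hQ, Polynomial.coeff_scaleRoots]
    rcases lt_trichotomy i n with hi | hi | hi
    · have hs0 : s i ≠ 0 := ne_zero_of_valuation_eq_one _ (hvs i)
      set P := ∏ j ∈ (Finset.range n).erase i, s j with hP
      have hPA : P ∈ A := Subalgebra.prod_mem A fun j _ => hs j
      have hSP : S = s i * P := by
        rw [hS, hP, Finset.mul_prod_erase _ _ (Finset.mem_range.mpr hi)]
      obtain ⟨m, hm⟩ : ∃ m, n - i = m + 1 := ⟨n - i - 1, by omega⟩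
      rw [hq i, hm, pow_succ', hSP]
      have : a i * (s i)⁻¹ * (s i * P * (s i * P) ^ m) = a i * P * (s i * P) ^ m := by
        field_simp
      rw [this]
      exact A.mul_mem (A.mul_mem (ha i) hPA) (A.pow_mem (A.mul_mem (hs i) hPA) m)
    · subst hi
      rw [hqm.coeff_natDegree, one_mul, Nat.sub_self, pow_zero]
      exact A.one_mem
    · rw [Polynomial.coeff_eq_zero_of_natDegree_lt hi, zero_mul]
      exact A.zero_mem
  have hlifts : Q ∈ Polynomial.lifts (algebraMap A K) := by
    rw [Polynomial.lifts_iff_coeff_lifts]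
    intro i
    exact ⟨⟨Q.coeff i, hQcoeff i⟩, rfl⟩
  have hQm : Q.Monic := (Polynomial.monic_scaleRoots_iff S).mpr hqm
  obtain ⟨P, hPQ, -, hPm⟩ := Polynomial.lifts_and_degree_eq_and_monic hlifts hQm
  refine ⟨P, hPm, ?_⟩
  have h0 : Polynomial.aeval (algebraMap K L S * b) Q = 0 := Polynomial.scaleRoots_aeval_eq_zero hqb
  rw [← hPQ, Polynomial.aeval_map_algebraMap, Polynomial.aeval_def] at h0
  exact h0

/-- **`R̃` is a local model of `W/k`** — DISCHARGE of the named statement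
`CP2008.NormalModelAboveLe` of `StableModelCriterion2008.lean`: for `L/K` finite and `R₀` a
(normal) local model of `V = W ∩ K`, the localisation `T` at the centre of `W` of the integral
closure `B` of the affine model of `R₀` in `L` is a local model of `W` containing
`R̃₀ = normalModelAbove W R₀`. [cite: CossartPiltant2008, Section 3 (HAL p. 4 l. 20–23) and Prop 6.2 (HAL p. 17 l. 43–44)]
[cite: Liu2002, Prop. 4.1.27, p. 122] -/
theorem normalModelAboveLe_holds : NormalModelAboveLe.{u} := by
  intro k K _ _ _ _hKfg L _ _ _ _ hfin W _hkW R₀ hR₀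
  classical
  obtain ⟨⟨A, hAfg, hAfrac, hAO, hR₀eq⟩, -⟩ := hR₀
  haveI : IsFractionRing A K := hAfrac
  haveI : FiniteDimensional K L := hfin
  let B : Subalgebra k L := integralClosureSub k (L := L) A
  have hmemB : ∀ x, x ∈ B ↔ IsIntegral A x := mem_integralClosureSub_iff A
  have hBfg : B.FG := integralClosureSub_fg A hAfg
  haveI hBfrac : IsFractionRing B L := isFractionRing_integralClosureSub A
  have hAW : ∀ a ∈ A, algebraMap K L a ∈ W := fun a ha =>
    ValuationSubring.mem_comap.mp
      (((W.comap (algebraMap K L)).mem_toSubring a).mp (hAO (show a ∈ A.toSubring from ha)))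
  have hBW : B.toSubring ≤ W.toSubring := fun x hx =>
    (W.mem_toSubring x).mpr (mem_of_isIntegral_of_forall_mem W A hAW ((hmemB x).mp hx))
  haveI : IsFractionRing B.toSubring L := isFractionRing_toSubring B
  -- `T := B` localised at the centre of `W`, realised inside `L`
  set P := Ideal.comap (Subring.inclusion hBW) (IsLocalRing.maximalIdeal W) with hP
  let T₁ : Subalgebra B.toSubring L :=
    Localization.subalgebra.ofField L P.primeCompl (Ideal.primeCompl_le_nonZeroDivisors _)
  have hT₁ : (T₁ : Set L) = {x | ∃ a ∈ B, ∃ s ∈ B, W.valuation s = 1 ∧ x = a * s⁻¹} :=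
    coe_ofField_centre W B.toSubring hBW
  have hBT : ∀ b : L, b ∈ B → b ∈ T₁ := fun b hb => by
    rw [← SetLike.mem_coe, hT₁]
    exact ⟨b, hb, 1, B.one_mem, by simp, by simp⟩
  let T : Subalgebra k L :=
    { carrier := T₁
      mul_mem' := fun ha hb => T₁.mul_mem ha hb
      one_mem' := T₁.one_mem
      add_mem' := fun ha hb => T₁.add_mem ha hb
      zero_mem' := T₁.zero_mem
      algebraMap_mem' := fun c => hBT _ (B.algebraMap_mem c) }
  have hT : (T : Set L) = {x | ∃ a ∈ B, ∃ s ∈ B, W.valuation s = 1 ∧ x = a * s⁻¹} := hT₁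
  refine ⟨T, ⟨B, hBfg, hBfrac, hBW, hT⟩, ?_⟩
  -- `R̃₀ ⊆ T`
  rintro x ⟨b, t, hb, ht, hvt, rfl⟩
  obtain ⟨S₁, hS₁A, hvS₁, hint₁⟩ := exists_mem_integral_mul_of_isIntegralOverSub W A R₀ hR₀eq hb
  obtain ⟨S₂, hS₂A, hvS₂, hint₂⟩ := exists_mem_integral_mul_of_isIntegralOverSub W A R₀ hR₀eq ht
  have hS₁0 : algebraMap K L S₁ ≠ 0 := ne_zero_of_valuation_eq_one W hvS₁
  have hS₂0 : algebraMap K L S₂ ≠ 0 := ne_zero_of_valuation_eq_one W hvS₂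
  have ht0 : t ≠ 0 := ne_zero_of_valuation_eq_one W hvt
  have hintS₁ : IsIntegral A (algebraMap K L S₁) := by
    have : algebraMap K L S₁ = algebraMap A L ⟨S₁, hS₁A⟩ := rfl
    rw [this]; exact isIntegral_algebraMap
  have hintS₂ : IsIntegral A (algebraMap K L S₂) := by
    have : algebraMap K L S₂ = algebraMap A L ⟨S₂, hS₂A⟩ := rfl
    rw [this]; exact isIntegral_algebraMap
  show b * t⁻¹ ∈ (T : Set L)
  rw [hT]
  refine ⟨algebraMap K L S₁ * b * algebraMap K L S₂, (hmemB _).mpr (hint₁.mul hintS₂),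
    algebraMap K L S₂ * t * algebraMap K L S₁, (hmemB _).mpr (hint₂.mul hintS₁), ?_, ?_⟩
  · rw [map_mul, map_mul, hvS₂, hvt, hvS₁, one_mul, one_mul]
  · field_simp

/-- **Corollary: Lemma 9.4 for `k = k̄` and `rat.rk W ≥ 2` from FIVE named hypotheses** — the
gen-9 assembly `tamePrimeDescentHighRank_of_leaves` (six hypotheses) with `NormalModelAboveLe`
discharged by `normalModelAboveLe_holds`; the remaining binder `hst : ConjugateStability` is
itself a tree theorem (`CP2008.conjugateStability_holds`, module `ConjugateStability2008.lean`,
not imported here). [cite: CossartPiltant2008, Lemma 9.2 (HAL Lemma 9.4, p. 30)] -/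
theorem tamePrimeDescentHighRank_of_leaves' (h93 : DescentBelowInertiaField.{u})
    (h₁ : TamePrimeDescentViaStableModel.{u}) (hcof : Cofinality.{u})
    (hFu : FuPrimaryTransform.{u}) (hst : ConjugateStability.{u}) :
    TamePrimeDescentHighRank.{u} :=
  tamePrimeDescentHighRank_of_leaves h93 h₁ hcof normalModelAboveLe_holds hFu hst

end IntegralClosureModel

end Literature.AlgebraicGeometry.CossartPiltant200819.CP2008
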